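import Mathlib
import Literature.Barriers.PneNP.Nechiporuk
import Literature.Computability.Complexity.CircuitSemantics
import Literature.Computability.Complexity.FormulaComposition
import HarnessLib

/-!
# Proof of Nechiporuk's theorem `Nechiporuk1966` (Jukna, Thm. 6.16)

`theorem Nechiporuk1966_holds : Nechiporuk1966` — the discharge of the named fact
`Literature.Barriers.PneNP.Nechiporuk1966` of `Literature/Barriers/PneNP/Nechiporuk.lean`
[Jukna2012, Thm. 6.16 (PDF pp. 188–189); Nechiporuk 1966]: for every Boolean function `f` of `n`
variables and every family `𝒴` of pairwise disjoint blocks of variables each of which contains a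
variable on which `f` depends essentially,
`¼ Σ_{Y ∈ 𝒴} log₂ s_Y(f) ≤ formulaSizeOver B2 f + 1`, where `s_Y(f)` is the number of distinct
subfunctions of `f` on `Y` and `formulaSizeOver B2 f` is the least number of gates of a formula
over the basis `B₂` of all gates of fan-in `≤ 2` computing `f` (tree model
`Literature.Computability.Complexity.Circuit`, straight-line programs with the formula property
`Circuit.IsFormula`).

**The printed proof** (S. Jukna, *Boolean Function Complexity*, Springer 2012, §6.5, proof of
Thm. 6.16, PDF pp. 188–189): in an optimal formula `F` let `lᵢ` be the number of leaves labelled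
by variables of `Yᵢ`, `Tᵢ` the union of the paths from these leaves to the output, `Wᵢ` its nodes
of in-degree `2` (`|Wᵢ| ≤ lᵢ − 1`) and `Pᵢ` the maximal `Wᵢ`-free paths (`|Pᵢ| ≤ 2(|Wᵢ| + 1)`);
after an assignment to the variables outside `Yᵢ` every path computes `0, 1, h` or `¬h` of the
function `h` at its first gate, so `sᵢ ≤ 4^{|Pᵢ|}` and `lᵢ ≥ ¼ log sᵢ`; summing,
`L_B(f) ≥ ¼ Σ log sᵢ`.

**This file** carries the argument out in the tree's model, in structural form:

* `FTree n` — formula trees (leaves = variables; inner nodes = a gate index label, a fan-in `k`,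
  a `k`-ary operation, `k` subtrees) with `eval`, `leaves`, `leavesIn Y` (= `lᵢ`), `gcount`
  (inner nodes), `FanIn2`;
* `FTree.unfold C d m` / `FTree.treeOf C` — the unfolding of a straight-line circuit into a
  tree (fuel `d`, by acyclicity complete for `d > m`): it computes what the circuit computes
  (`eval_treeOf`, through the gate equations `getD_transcript_eq_gateValue` of
  `CircuitSemantics`), has fan-in `≤ 2` over `B₂`, and — the formula property — unfolds every
  gate AT MOST ONCE (`occ_unfold_le_one`: the number `occ j` of copies of gate `j` satisfies
  `occ j = [j = root] + Σ_i occ i · #{slots of gate i wired to j}` and `Σ_i #{slots wired to j}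
  = refCount j ≤ 1`), whence `gcount (treeOf C) ≤ C.size` and `leaves ≤ gcount + 1 ≤ size + 1`
  (this `+ 1` is the leaves-versus-gates slack in the vendored statement);
* the count (`FTree.four_mul_card_cl_le`): with `cl S := {φ ∘ g | φ : Bool → Bool, g ∈ S}`
  (the four maps `0, 1, h, ¬h`), every tree `T` of fan-in `≤ 2` with `l = l_Y(T) ≥ 1` has
  `4 · |cl (subfunctions T Y)| ≤ 16^l`: a gate with exactly one input reading `Y` is a path step
  (`S(T) ⊆ cl S(child)`, and `cl ∘ cl = cl`), a gate with both inputs reading `Y` is a node of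
  `Wᵢ` (`|S(T)| ≤ |S(T₀)| · |S(T₁)|`); hence `s_Y ≤ 16^l / 4 = 4^{2l−1}` and `log₂ s_Y ≤ 4 l_Y`;
* `lᵢ ≥ 1` from the essential-variable hypothesis (`leavesIn_pos_of_isEssentialVar`: a tree
  without leaves in `Y` computes a function not depending on `Y`), `Σ_Y l_Y ≤ leaves` for
  disjoint blocks (`sum_leavesIn_le`);
* `exists_formula`: every `f` has a `B₂`-formula (its canonical DNF, built with
  `Circuit.binop` / `Circuit.input` / `Circuit.const` of `FormulaComposition`), so that the
  infimum `formulaSizeOver B2 f` is attained (`Nat.sInf_mem`) rather than the junk value `0`;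
* assembly: `nechiporukSum_le_of_formula` (`Σ_Y log₂ s_Y ≤ 4 (size + 1)` for one formula) and
  `Nechiporuk1966_holds`.

No new named facts; everything here is proved.

## References

* [Jukna2012] S. Jukna, *Boolean Function Complexity: Advances and Frontiers*, Springer 2012
  (Algorithms and Combinatorics 27): §6.5, Thm. 6.16 and its proof (PDF pp. 188–189); §1.1
  (DNF), §1.2 (formulas over a basis).
* É. I. Nechiporuk, *On a Boolean function*, Dokl. Akad. Nauk SSSR 169 (1966) 765–766
  (Soviet Math. Dokl. 7, 999–1000) — the original, as cited by [Jukna2012].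
-/

noncomputable section

namespace Literature.Barriers.PneNP.Nechiporuk

open Finset Literature.Computability.Complexity

variable {n : ℕ}

/-! ### Formula trees -/

/-- **Formula trees** over the variables `x₀, …, x_{n−1}`: a leaf `var i` is the variable `xᵢ`;
an inner node `node j k op c` carries a label `j` (the index of the gate of the straight-line
program it was unfolded from; otherwise arbitrary), its fan-in `k`, a `k`-ary Boolean operation
`op` and its `k` subtrees `c`. [cite: Jukna2012, §1.2 (formulas as trees)] -/
inductive FTree (n : ℕ) : Type
  | var : Fin n → FTree n
  | node : ℕ → (k : ℕ) → ((Fin k → Bool) → Bool) → (Fin k → FTree n) → FTree n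

namespace FTree

/-- Evaluation of a formula tree. [folklore] -/
def eval : FTree n → (Fin n → Bool) → Bool
  | var i, x => x i
  | node _ _ op c, x => op fun a => eval (c a) x

/-- Number of leaves. [folklore] -/
def leaves : FTree n → ℕ
  | var _ => 1
  | node _ k _ c => ∑ a : Fin k, leaves (c a)

/-- Number of leaves labelled by a variable of the block `Y` (the `lᵢ` of the printed proof).
[cite: Jukna2012, proof of Thm. 6.16 (PDF p. 188)] -/
def leavesIn (Y : Finset (Fin n)) : FTree n → ℕ
  | var i => if i ∈ Y then 1 else 0
  | node _ k _ c => ∑ a : Fin k, leavesIn Y (c a)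

/-- Number of inner nodes, with multiplicity. [folklore] -/
def gcount : FTree n → ℕ
  | var _ => 0
  | node _ k _ c => ∑ a : Fin k, gcount (c a) + 1

/-- Every inner node has fan-in at most two. [folklore] -/
def FanIn2 : FTree n → Prop
  | var _ => True
  | node _ k _ c => k ≤ 2 ∧ ∀ a, FanIn2 (c a)

/-- Number of inner nodes labelled `j`. [folklore] -/
def occ (j : ℕ) : FTree n → ℕ
  | var _ => 0
  | node i k _ c => ∑ a : Fin k, occ j (c a) + if i = j then 1 else 0

/-- Indicator: the root is an inner node labelled `j`. [folklore] -/
def rootInd (j : ℕ) : FTree n → ℕ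
  | var _ => 0
  | node i _ _ _ => if i = j then 1 else 0

/-- Number of (inner node, argument) pairs whose child is an inner node labelled `j`. [folklore] -/
def childOcc (j : ℕ) : FTree n → ℕ
  | var _ => 0
  | node _ k _ c => ∑ a : Fin k, (rootInd j (c a) + childOcc j (c a))

section simp_lemmas
variable (i : Fin n) (j : ℕ) (k : ℕ) (op : (Fin k → Bool) → Bool) (c : Fin k → FTree n)

/-- `eval` at a leaf. [folklore] -/
@[simp] theorem eval_var (x : Fin n → Bool) : (var i).eval x = x i := rfl
/-- `eval` at an inner node. [folklore] -/
@[simp] theorem eval_node (x : Fin n → Bool) :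
    (node j k op c).eval x = op fun a => (c a).eval x := rfl
/-- `leaves` of a leaf. [folklore] -/
@[simp] theorem leaves_var : (var i).leaves = 1 := rfl
/-- `leaves` of an inner node. [folklore] -/
@[simp] theorem leaves_node : (node j k op c).leaves = ∑ a, (c a).leaves := rfl
/-- `leavesIn` of a leaf. [folklore] -/
@[simp] theorem leavesIn_var (Y : Finset (Fin n)) :
    (var i).leavesIn Y = if i ∈ Y then 1 else 0 := rfl
/-- `leavesIn` of an inner node. [folklore] -/
@[simp] theorem leavesIn_node (Y : Finset (Fin n)) :
    (node j k op c).leavesIn Y = ∑ a, (c a).leavesIn Y := rfl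
/-- `gcount` of a leaf. [folklore] -/
@[simp] theorem gcount_var : (var i).gcount = 0 := rfl
/-- `gcount` of an inner node. [folklore] -/
@[simp] theorem gcount_node : (node j k op c).gcount = ∑ a, (c a).gcount + 1 := rfl
/-- `FanIn2` of a leaf. [folklore] -/
@[simp] theorem fanIn2_var : (var i).FanIn2 ↔ True := Iff.rfl
/-- `FanIn2` of an inner node. [folklore] -/
@[simp] theorem fanIn2_node : (node j k op c).FanIn2 ↔ k ≤ 2 ∧ ∀ a, (c a).FanIn2 := Iff.rfl
/-- `occ` of a leaf. [folklore] -/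
@[simp] theorem occ_var (l : ℕ) : (var i).occ l = 0 := rfl
/-- `occ` of an inner node. [folklore] -/
@[simp] theorem occ_node (l : ℕ) :
    (node j k op c).occ l = ∑ a, (c a).occ l + if j = l then 1 else 0 := rfl
/-- `rootInd` of a leaf. [folklore] -/
@[simp] theorem rootInd_var (l : ℕ) : (var i).rootInd l = 0 := rfl
/-- `rootInd` of an inner node. [folklore] -/
@[simp] theorem rootInd_node (l : ℕ) : (node j k op c).rootInd l = if j = l then 1 else 0 := rfl
/-- `childOcc` of a leaf. [folklore] -/
@[simp] theorem childOcc_var (l : ℕ) : (var i).childOcc l = 0 := rfl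
/-- `childOcc` of an inner node. [folklore] -/
@[simp] theorem childOcc_node (l : ℕ) :
    (node j k op c).childOcc l = ∑ a, ((c a).rootInd l + (c a).childOcc l) := rfl

end simp_lemmas

/-- In a tree of fan-in `≤ 2`, leaves `≤` inner nodes `+ 1`. [folklore] -/
theorem leaves_le_gcount_succ : ∀ T : FTree n, T.FanIn2 → T.leaves ≤ T.gcount + 1
  | var _, _ => by simp
  | node _ k _ c, h => by
    rw [fanIn2_node] at h
    obtain ⟨hk, hc⟩ := h
    simp only [leaves_node, gcount_node]
    have ih : ∀ a, (c a).leaves ≤ (c a).gcount + 1 := fun a => leaves_le_gcount_succ (c a) (hc a)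
    calc ∑ a, (c a).leaves ≤ ∑ a, ((c a).gcount + 1) := sum_le_sum fun a _ => ih a
      _ = ∑ a, (c a).gcount + k := by rw [sum_add_distrib]; simp
      _ ≤ ∑ a, (c a).gcount + 1 + 1 := by omega

/-- `occ = rootInd + childOcc`. [folklore] -/
theorem occ_eq_rootInd_add_childOcc (j : ℕ) : ∀ T : FTree n, T.occ j = T.rootInd j + T.childOcc j
  | var _ => rfl
  | node i k op c => by
    simp only [occ_node, rootInd_node, childOcc_node]
    have ih : ∀ a, (c a).occ j = (c a).rootInd j + (c a).childOcc j := fun a =>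
      occ_eq_rootInd_add_childOcc j (c a)
    simp only [ih]
    ring

/-! ### Unfolding a straight-line formula into a tree -/

/-- The tree of a wire, given the trees of the gates. [folklore] -/
def ofWire (t : ℕ → FTree n) : Fin n ⊕ ℕ → FTree n
  | .inl i => var i
  | .inr m => t m

/-- The tree of an input wire is a leaf. [folklore] -/
@[simp] theorem ofWire_inl (t : ℕ → FTree n) (i : Fin n) : ofWire t (.inl i) = var i := rfl
/-- The tree of a gate wire is the tree of that gate. [folklore] -/
@[simp] theorem ofWire_inr (t : ℕ → FTree n) (m : ℕ) : ofWire t (.inr m) = t m := rfl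

/-- Junk tree (label `m`, fan-in `0`, constant `false`), the value of `unfold` out of range /
out of fuel. [folklore] -/
def junk (m : ℕ) : FTree n := node m 0 (fun _ => false) Fin.elim0

/-- **Unfolding** of gate `m` of the straight-line program `C` into a tree, by recursion on a
fuel parameter `d`: gate `m` becomes an inner node labelled `m` whose children are the trees of
its argument wires (input wires become leaves, gate wires are unfolded with fuel `d − 1`); by
acyclicity (`Circuit.wf`: gate `m` reads gates `< m` only) the unfolding is complete as soon as
`d > m`. Out of fuel or out of range: `junk`. [folklore] -/
def unfold (C : Circuit (Fin n)) : ℕ → ℕ → FTree n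
  | 0, m => junk m
  | d + 1, m =>
    if hm : m < C.gates.length then
      node m (C.gates[m]).arity (C.gates[m]).op fun a =>
        ofWire (fun m' => unfold C d m') ((C.gates[m]).args a)
    else junk m

/-- Without fuel the unfolding is junk. [folklore] -/
@[simp] theorem unfold_zero (C : Circuit (Fin n)) (m : ℕ) : unfold C 0 m = junk m := rfl

/-- Unfolding equation at a genuine gate. [folklore] -/
theorem unfold_succ_of_lt (C : Circuit (Fin n)) (d : ℕ) {m : ℕ} (hm : m < C.gates.length) :
    unfold C (d + 1) m = node m (C.gates[m]).arity (C.gates[m]).op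
      (fun a => ofWire (unfold C d) ((C.gates[m]).args a)) := by
  rw [unfold, dif_pos hm]

/-- Unfolding equation out of range. [folklore] -/
theorem unfold_succ_of_not_lt (C : Circuit (Fin n)) (d : ℕ) {m : ℕ} (hm : ¬ m < C.gates.length) :
    unfold C (d + 1) m = junk m := by
  rw [unfold, dif_neg hm]

/-- The unfolded tree of gate `m` computes the value of gate `m`. [folklore] -/
theorem eval_unfold (C : Circuit (Fin n)) (x : Fin n → Bool) :
    ∀ d m, m < d → m < C.gates.length →
      (unfold C d m).eval x = (transcript x [] C.gates).getD m false
  | 0, _, hd, _ => absurd hd (Nat.not_lt_zero _)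
  | d + 1, m, hd, hm => by
    rw [getD_transcript_eq_gateValue C x m hm, unfold_succ_of_lt C d hm, eval_node, gateValue]
    congr 1
    funext a
    cases hw : (C.gates[m]).args a with
    | inl i => rfl
    | inr m' =>
      have hm' : m' < m := C.wf m hm a m' hw
      rw [ofWire_inr, wireVal]
      exact eval_unfold C x d m' (by omega) (by omega)

/-- The unfolded trees of a `B₂`-circuit have fan-in `≤ 2`. [folklore] -/
theorem fanIn2_unfold (C : Circuit (Fin n)) (hB : C.IsOver B2) : ∀ d m, (unfold C d m).FanIn2
  | 0, m => ⟨Nat.zero_le _, fun a => a.elim0⟩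
  | d + 1, m => by
    by_cases hm : m < C.gates.length
    · rw [unfold_succ_of_lt C d hm, fanIn2_node]
      refine ⟨hB _ (List.getElem_mem hm), fun a => ?_⟩
      cases (C.gates[m]).args a with
      | inl i => trivial
      | inr m' => exact fanIn2_unfold C hB d m'
    · rw [unfold_succ_of_not_lt C d hm]
      exact ⟨Nat.zero_le _, fun a => a.elim0⟩

/-- The root of `unfold C d m` is labelled `m`. [folklore] -/
theorem rootInd_unfold (C : Circuit (Fin n)) (j d m : ℕ) :
    (unfold C d m).rootInd j = if m = j then 1 else 0 := by
  cases d with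
  | zero => rfl
  | succ d =>
    by_cases hm : m < C.gates.length
    · rw [unfold_succ_of_lt C d hm, rootInd_node]
    · rw [unfold_succ_of_not_lt C d hm]; rfl

/-- Labels in `unfold C d m` are `≤ m`. [folklore] -/
theorem occ_unfold_eq_zero (C : Circuit (Fin n)) : ∀ d m j, m < j → (unfold C d m).occ j = 0
  | 0, m, j, h => by simp [junk, h.ne]
  | d + 1, m, j, h => by
    by_cases hm : m < C.gates.length
    · rw [unfold_succ_of_lt C d hm, occ_node, if_neg h.ne, add_zero]
      refine sum_eq_zero fun a _ => ?_
      cases hw : (C.gates[m]).args a with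
      | inl i => rfl
      | inr m' =>
        have hm' : m' < m := C.wf m hm a m' hw
        exact occ_unfold_eq_zero C d m' j (by omega)
    · rw [unfold_succ_of_not_lt C d hm]
      simp [junk, h.ne]

/-- Number of argument slots of gate `i` of `C` wired to gate `j` (`0` if `i` is out of range).
[folklore] -/
def slots (C : Circuit (Fin n)) (j i : ℕ) : ℕ :=
  if h : i < C.gates.length then
    (univ.filter fun a : Fin (C.gates[i]).arity => (C.gates[i]).args a = .inr j).card
  else 0

/-- Gates only read earlier gates. [folklore] -/
theorem lt_of_slots_ne_zero (C : Circuit (Fin n)) {j i : ℕ} (h : slots C j i ≠ 0) : j < i := by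
  by_contra hji
  apply h
  unfold slots
  split_ifs with hi
  · exact card_eq_zero.2 (filter_eq_empty_iff.2 fun a _ ha => hji (C.wf i hi a j ha))
  · rfl

/-- The slot counts sum to the reference count. [folklore] -/
theorem sum_slots_eq_refCount (C : Circuit (Fin n)) (j : ℕ) :
    ∑ i ∈ range C.gates.length, slots C j i = C.refCount j := by
  let F : Gate (Fin n) → ℕ := fun g =>
    (univ.filter fun a : Fin g.arity => (g.args a).getRight? = some j).card
  have hF : ∀ i : Fin C.gates.length, slots C j i = F (C.gates[(i : ℕ)]) := by
    intro i
    unfold slots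
    rw [dif_pos i.2]
    simp only [F, Sum.getRight?_eq_some_iff]
  calc ∑ i ∈ range C.gates.length, slots C j i
      = ∑ i : Fin C.gates.length, slots C j i := sum_range _
    _ = ∑ i : Fin C.gates.length, F (C.gates[(i : ℕ)]) := Fintype.sum_congr _ _ hF
    _ = (List.ofFn fun i : Fin C.gates.length => F (C.gates[(i : ℕ)])).sum := (Fin.sum_ofFn _).symm
    _ = (C.gates.map F).sum := by rw [List.ofFn_getElem_eq_map]
    _ = C.refCount j := rfl

/-- `childOcc` of an unfolded tree, through the slot counts. [folklore] -/
theorem childOcc_unfold (C : Circuit (Fin n)) (j : ℕ) : ∀ d m, m < d → m < C.gates.length →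
    (unfold C d m).childOcc j = ∑ i ∈ range C.gates.length, (unfold C d m).occ i * slots C j i
  | 0, _, hd, _ => absurd hd (Nat.not_lt_zero _)
  | d + 1, m, hd, hm => by
    rw [unfold_succ_of_lt C d hm]
    simp only [childOcc_node, occ_node]
    have hchild : ∀ a : Fin (C.gates[m]).arity,
        (ofWire (unfold C d) ((C.gates[m]).args a)).childOcc j =
          ∑ i ∈ range C.gates.length,
            (ofWire (unfold C d) ((C.gates[m]).args a)).occ i * slots C j i := by
      intro a
      cases hw : (C.gates[m]).args a with
      | inl i => simp
      | inr m' =>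
        have hm' := C.wf m hm a m' hw
        exact childOcc_unfold C j d m' (by omega) (by omega)
    have hroot :
        ∑ a : Fin (C.gates[m]).arity, (ofWire (unfold C d) ((C.gates[m]).args a)).rootInd j =
        slots C j m := by
      unfold slots
      rw [dif_pos hm, card_filter]
      refine sum_congr rfl fun a _ => ?_
      cases hw : (C.gates[m]).args a with
      | inl i => simp
      | inr m' => rw [ofWire_inr, rootInd_unfold]; simp
    rw [sum_add_distrib, hroot, sum_congr rfl fun a _ => hchild a, sum_comm]
    simp only [add_mul, sum_add_distrib, sum_mul, boole_mul]
    rw [sum_ite_eq, if_pos (mem_range.2 hm), add_comm]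

/-- `gcount` of an unfolded tree is the total number of occurrences. [folklore] -/
theorem gcount_unfold (C : Circuit (Fin n)) : ∀ d m, m < d → m < C.gates.length →
    (unfold C d m).gcount = ∑ i ∈ range C.gates.length, (unfold C d m).occ i
  | 0, _, hd, _ => absurd hd (Nat.not_lt_zero _)
  | d + 1, m, hd, hm => by
    rw [unfold_succ_of_lt C d hm]
    simp only [gcount_node, occ_node]
    have hchild : ∀ a : Fin (C.gates[m]).arity, (ofWire (unfold C d) ((C.gates[m]).args a)).gcount =
        ∑ i ∈ range C.gates.length, (ofWire (unfold C d) ((C.gates[m]).args a)).occ i := by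
      intro a
      cases hw : (C.gates[m]).args a with
      | inl i => simp
      | inr m' =>
        have hm' := C.wf m hm a m' hw
        exact gcount_unfold C d m' (by omega) (by omega)
    rw [sum_congr rfl fun a _ => hchild a, sum_comm, sum_add_distrib, sum_ite_eq,
      if_pos (mem_range.2 hm)]

/-- **In a formula every gate is unfolded at most once.** [folklore] -/
theorem occ_unfold_le_one (C : Circuit (Fin n)) (hF : C.IsFormula) {d m : ℕ} (hd : m < d)
    (hm : m < C.gates.length) (j : ℕ) : (unfold C d m).occ j ≤ 1 := by
  set T := unfold C d m with hT
  have hocc : ∀ j, T.occ j = (if m = j then 1 else 0) +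
      ∑ i ∈ range C.gates.length, T.occ i * slots C j i := fun j => by
    rw [occ_eq_rootInd_add_childOcc, hT, rootInd_unfold, childOcc_unfold C j d m hd hm]
  suffices H : ∀ t j, m ≤ j + t → T.occ j ≤ 1 from H m j (by omega)
  intro t
  induction t with
  | zero =>
    intro j hj
    rcases (show m ≤ j from by simpa using hj).eq_or_lt with rfl | hlt
    · rw [hocc, if_pos rfl]
      suffices h0 : ∑ i ∈ range C.gates.length, T.occ i * slots C m i = 0 by omega
      refine sum_eq_zero fun i _ => ?_
      by_cases hs : slots C m i = 0
      · rw [hs, mul_zero]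
      · rw [hT, occ_unfold_eq_zero C d m i (lt_of_slots_ne_zero C hs), zero_mul]
    · rw [hT, occ_unfold_eq_zero C d m j hlt]; exact Nat.zero_le _
  | succ t ih =>
    intro j hj
    by_cases hj' : m ≤ j + t
    · exact ih j hj'
    have hmj : m ≠ j := by omega
    rw [hocc, if_neg hmj, zero_add]
    calc ∑ i ∈ range C.gates.length, T.occ i * slots C j i
        ≤ ∑ i ∈ range C.gates.length, slots C j i := by
          refine sum_le_sum fun i _ => ?_
          by_cases hs : slots C j i = 0
          · rw [hs, mul_zero]
          · have hji := lt_of_slots_ne_zero C hs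
            calc T.occ i * slots C j i ≤ 1 * slots C j i :=
                  Nat.mul_le_mul_right _ (ih i (by omega))
              _ = slots C j i := one_mul _
      _ = C.refCount j := sum_slots_eq_refCount C j
      _ ≤ 1 := hF j

/-- The tree of a circuit: the unfolding of its output wire. [folklore] -/
def treeOf (C : Circuit (Fin n)) : FTree n := ofWire (unfold C C.gates.length) C.output

/-- The tree of a circuit computes what the circuit computes. [folklore] -/
theorem eval_treeOf (C : Circuit (Fin n)) (x : Fin n → Bool) : (treeOf C).eval x = C.eval x := by
  rw [eval_eq_wireVal]
  unfold treeOf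
  cases hco : C.output with
  | inl i => rfl
  | inr m =>
    rw [ofWire_inr, wireVal]
    exact eval_unfold C x _ m (C.wf_output m hco) (C.wf_output m hco)

/-- The tree of a `B₂`-circuit has fan-in `≤ 2`. [folklore] -/
theorem fanIn2_treeOf (C : Circuit (Fin n)) (hB : C.IsOver B2) : (treeOf C).FanIn2 := by
  unfold treeOf
  cases C.output with
  | inl i => trivial
  | inr m => exact fanIn2_unfold C hB _ m

/-- **The tree of a formula has at most as many inner nodes as the formula has gates.**
[folklore] -/
theorem gcount_treeOf_le (C : Circuit (Fin n)) (hF : C.IsFormula) : (treeOf C).gcount ≤ C.size := by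
  unfold treeOf
  cases hco : C.output with
  | inl i => exact Nat.zero_le _
  | inr m =>
    have hm := C.wf_output m hco
    rw [ofWire_inr, gcount_unfold C _ m hm hm]
    calc ∑ i ∈ range C.gates.length, (unfold C C.gates.length m).occ i
        ≤ ∑ _i ∈ range C.gates.length, 1 := sum_le_sum fun i _ => occ_unfold_le_one C hF hm hm i
      _ = C.size := by simp [Circuit.size]

/-! ### Leaves: blocks, essential variables -/

section Blocks

variable {Y : Finset (Fin n)}

/-- A tree without leaves in `Y` computes a function not depending on the variables in `Y`.
[folklore] -/
theorem eval_congr_of_leavesIn_eq_zero : ∀ (T : FTree n), T.leavesIn Y = 0 →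
    ∀ x x' : Fin n → Bool, (∀ i ∉ Y, x i = x' i) → T.eval x = T.eval x'
  | var i, h, x, x', hxx' => by
    rw [leavesIn_var] at h
    have hi : i ∉ Y := fun hi => by simp [hi] at h
    exact hxx' i hi
  | node _ k op c, h, x, x', hxx' => by
    rw [leavesIn_node] at h
    have h' : ∀ a, (c a).leavesIn Y = 0 := fun a => (sum_eq_zero_iff.1 h) a (mem_univ a)
    rw [eval_node, eval_node]
    congr 1
    funext a
    exact eval_congr_of_leavesIn_eq_zero (c a) (h' a) x x' hxx'

/-- Without leaves in `Y`, every subfunction on `Y` is constant. [folklore] -/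
theorem subfunction_eq_const_of_leavesIn_eq_zero (T : FTree n) (h : T.leavesIn Y = 0)
    (ρ : Fin n → Bool) : ∃ b, subfunction T.eval Y ρ = fun _ => b := by
  refine ⟨subfunction T.eval Y ρ fun _ => false, funext fun y => ?_⟩
  simp only [subfunction]
  exact eval_congr_of_leavesIn_eq_zero T h _ _ fun i hi => by simp [hi]

/-- **An essential variable is read**: if `xᵢ`, `i ∈ Y`, is essential for the function computed
by `T`, then `T` has a leaf in `Y` (the `lᵢ ≥ 1` silently used in the printed proof).
[cite: Jukna2012, proof of Thm. 6.16 (PDF p. 188)] -/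
theorem leavesIn_pos_of_isEssentialVar (T : FTree n) {i : Fin n} (hi : i ∈ Y)
    (hess : IsEssentialVar T.eval i) : 1 ≤ T.leavesIn Y := by
  by_contra h0
  obtain ⟨x, hx⟩ := hess
  refine hx (eval_congr_of_leavesIn_eq_zero (Y := Y) T (by omega) _ _ fun j hj => ?_)
  have hji : j ≠ i := fun h => hj (h ▸ hi)
  rw [Function.update_of_ne hji, Function.update_of_ne hji]

/-- Disjoint blocks: `Σ_Y l_Y(T) ≤ leaves(T)`. [folklore] -/
theorem sum_leavesIn_le (𝒴 : Finset (Finset (Fin n)))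
    (hdisj : (𝒴 : Set (Finset (Fin n))).PairwiseDisjoint id) :
    ∀ T : FTree n, ∑ Y ∈ 𝒴, T.leavesIn Y ≤ T.leaves
  | var i => by
    simp only [leavesIn_var, leaves_var]
    rw [← card_filter]
    refine card_le_one.2 fun Y hY Y' hY' => ?_
    rw [mem_filter] at hY hY'
    by_contra hne
    exact disjoint_left.1 (hdisj hY.1 hY'.1 hne) hY.2 hY'.2
  | node _ k _ c => by
    simp only [leavesIn_node, leaves_node]
    rw [sum_comm]
    exact sum_le_sum fun a _ => sum_leavesIn_le 𝒴 hdisj (c a)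

end Blocks

/-! ### Counting subfunctions: `4 · |cl S_Y(T)| ≤ 16 ^ l_Y(T)` -/

section Count

variable {Y : Finset (Fin n)}

/-- The closure of a set of functions under post-composition with the four maps `Bool → Bool`
(`h ↦ 0, 1, h, ¬h` in the printed proof). [cite: Jukna2012, proof of Thm. 6.16 (PDF p. 189)] -/
def cl (S : Finset ((Y → Bool) → Bool)) : Finset ((Y → Bool) → Bool) :=
  (S ×ˢ (univ : Finset (Bool → Bool))).image fun p => p.2 ∘ p.1

/-- `φ ∘ g ∈ cl S` for `g ∈ S`. [folklore] -/
theorem comp_mem_cl {S : Finset ((Y → Bool) → Bool)} {g : (Y → Bool) → Bool} (hg : g ∈ S)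
    (φ : Bool → Bool) : φ ∘ g ∈ cl S :=
  mem_image.2 ⟨(g, φ), mem_product.2 ⟨hg, mem_univ _⟩, rfl⟩

/-- `S ⊆ cl S` (`φ = id`). [folklore] -/
theorem subset_cl (S : Finset ((Y → Bool) → Bool)) : S ⊆ cl S := fun _ hg => comp_mem_cl hg id

/-- `cl (cl S) ⊆ cl S`: the maps `Bool → Bool` are closed under composition (a chain of
path gates is one path). [folklore] -/
theorem cl_cl_subset (S : Finset ((Y → Bool) → Bool)) : cl (cl S) ⊆ cl S := by
  intro h hh
  obtain ⟨⟨g', ψ⟩, hg', rfl⟩ := mem_image.1 hh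
  obtain ⟨hg'S, -⟩ := mem_product.1 hg'
  obtain ⟨⟨g, φ⟩, hg, rfl⟩ := mem_image.1 hg'S
  obtain ⟨hgS, -⟩ := mem_product.1 hg
  exact comp_mem_cl hgS (ψ ∘ φ)

/-- `cl` is monotone. [folklore] -/
theorem cl_mono {S S' : Finset ((Y → Bool) → Bool)} (h : S ⊆ S') : cl S ⊆ cl S' :=
  image_subset_image (product_subset_product_left h)

/-- `|cl S| ≤ 4 |S|`. [folklore] -/
theorem card_cl_le (S : Finset ((Y → Bool) → Bool)) : (cl S).card ≤ 4 * S.card := by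
  calc (cl S).card ≤ (S ×ˢ (univ : Finset (Bool → Bool))).card := card_image_le
    _ = 4 * S.card := by
        rw [card_product, card_univ, Fintype.card_fun, Fintype.card_bool]
        ring

/-- The "path" step: if every subfunction of `f` is a unary map applied to the corresponding
subfunction of `g`, the subfunctions of `f` lie in the closure of those of `g`.
[cite: Jukna2012, proof of Thm. 6.16 (PDF p. 189)] -/
theorem subfunctions_subset_cl {f g : (Fin n → Bool) → Bool}
    (h : ∀ ρ : Fin n → Bool, ∃ φ : Bool → Bool, subfunction f Y ρ = φ ∘ subfunction g Y ρ) :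
    subfunctions f Y ⊆ cl (subfunctions g Y) := by
  intro s hs
  simp only [subfunctions, mem_image] at hs
  obtain ⟨ρ, -, rfl⟩ := hs
  obtain ⟨φ, hφ⟩ := h ρ
  rw [hφ]
  exact comp_mem_cl (mem_image_of_mem (subfunction g Y) (mem_univ ρ)) φ

/-- The "branching" step: the subfunctions of a gate are determined by those of its inputs.
[cite: Jukna2012, proof of Thm. 6.16 (PDF p. 189)] -/
theorem card_subfunctions_node_le {k : ℕ} (op : (Fin k → Bool) → Bool)
    (g : Fin k → (Fin n → Bool) → Bool) :
    (subfunctions (fun x => op fun a => g a x) Y).card ≤ ∏ a, (subfunctions (g a) Y).card := by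
  let F : (Fin k → (Y → Bool) → Bool) → (Y → Bool) → Bool := fun s y => op fun a => s a y
  have hsub : subfunctions (fun x => op fun a => g a x) Y ⊆
      (Fintype.piFinset fun a => subfunctions (g a) Y).image F := by
    intro s hs
    simp only [subfunctions, mem_image] at hs
    obtain ⟨ρ, -, rfl⟩ := hs
    exact mem_image.2 ⟨fun a => subfunction (g a) Y ρ,
      Fintype.mem_piFinset.2 fun a => mem_image_of_mem _ (mem_univ ρ), rfl⟩
  calc (subfunctions (fun x => op fun a => g a x) Y).card
      ≤ ((Fintype.piFinset fun a => subfunctions (g a) Y).image F).card := card_le_card hsub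
    _ ≤ (Fintype.piFinset fun a => subfunctions (g a) Y).card := card_image_le
    _ = ∏ a, (subfunctions (g a) Y).card := Fintype.card_piFinset _

/-- **The heart of Nechiporuk's argument** (`sᵢ ≤ 4^{|Pᵢ|}`, `|Pᵢ| ≤ 2(|Wᵢ| + 1)`, `|Wᵢ| ≤ lᵢ − 1`
in structural form): for a tree of fan-in `≤ 2` with `l ≥ 1` leaves in `Y`,
`4 · |cl S_Y(T)| ≤ 16^l`. [cite: Jukna2012, proof of Thm. 6.16 (PDF pp. 188–189)] -/
theorem four_mul_card_cl_le (Y : Finset (Fin n)) : ∀ T : FTree n, T.FanIn2 → 1 ≤ T.leavesIn Y →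
    4 * (cl (subfunctions T.eval Y)).card ≤ 16 ^ T.leavesIn Y := by
  intro T
  induction T with
  | var i =>
    intro _ hl
    rw [leavesIn_var] at hl ⊢
    have hi : i ∈ Y := by
      by_contra hi
      rw [if_neg hi] at hl
      exact Nat.not_succ_le_zero 0 hl
    rw [if_pos hi, pow_one]
    have h1 : (subfunctions (var i).eval Y).card ≤ 1 := by
      refine card_le_one.2 fun s hs t ht => ?_
      simp only [subfunctions, mem_image] at hs ht
      obtain ⟨ρ, -, rfl⟩ := hs
      obtain ⟨ρ', -, rfl⟩ := ht
      funext y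
      simp [subfunction, hi]
    calc 4 * (cl (subfunctions (var i).eval Y)).card
        ≤ 4 * (4 * (subfunctions (var i).eval Y).card) := Nat.mul_le_mul_left 4 (card_cl_le _)
      _ ≤ 4 * (4 * 1) := by gcongr
      _ = 16 := by norm_num
  | node j k op c ih =>
    intro hfan hl
    rw [fanIn2_node] at hfan
    obtain ⟨hk, hc⟩ := hfan
    rw [leavesIn_node] at hl ⊢
    interval_cases k
    · simp at hl
    · -- fan-in 1: a "path" gate
      rw [Fin.sum_univ_one] at hl ⊢
      have hsub : subfunctions (node j 1 op c).eval Y ⊆ cl (subfunctions (c 0).eval Y) := by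
        refine subfunctions_subset_cl fun ρ => ⟨fun b => op fun _ => b, funext fun y => ?_⟩
        simp only [subfunction, Function.comp, eval_node]
        congr 1
        funext a
        rw [Subsingleton.elim a 0]
      calc 4 * (cl (subfunctions (node j 1 op c).eval Y)).card
          ≤ 4 * (cl (cl (subfunctions (c 0).eval Y))).card :=
            Nat.mul_le_mul_left 4 (card_le_card (cl_mono hsub))
        _ ≤ 4 * (cl (subfunctions (c 0).eval Y)).card :=
            Nat.mul_le_mul_left 4 (card_le_card (cl_cl_subset _))
        _ ≤ 16 ^ (c 0).leavesIn Y := ih 0 (hc 0) hl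
    · -- fan-in 2
      rw [Fin.sum_univ_two] at hl ⊢
      by_cases h0 : 1 ≤ (c 0).leavesIn Y <;> by_cases h1 : 1 ≤ (c 1).leavesIn Y
      · -- both inputs read `Y`: a node of `Wᵢ`
        have hprod := card_subfunctions_node_le (Y := Y) op fun a => (c a).eval
        rw [Fin.prod_univ_two] at hprod
        have he : (node j 2 op c).eval = fun x => op fun a => (c a).eval x := rfl
        rw [he]
        have ih0 := ih 0 (hc 0) h0
        have ih1 := ih 1 (hc 1) h1
        calc 4 * (cl (subfunctions (fun x => op fun a => (c a).eval x) Y)).card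
            ≤ 4 * (4 * (subfunctions (fun x => op fun a => (c a).eval x) Y).card) :=
              Nat.mul_le_mul_left 4 (card_cl_le _)
          _ ≤ 4 * (4 * ((subfunctions (c 0).eval Y).card * (subfunctions (c 1).eval Y).card)) :=
              Nat.mul_le_mul_left 4 (Nat.mul_le_mul_left 4 hprod)
          _ ≤ 4 * (4 * ((cl (subfunctions (c 0).eval Y)).card *
                (cl (subfunctions (c 1).eval Y)).card)) :=
              Nat.mul_le_mul_left 4 (Nat.mul_le_mul_left 4 (Nat.mul_le_mul
                (card_le_card (subset_cl _)) (card_le_card (subset_cl _))))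
          _ = (4 * (cl (subfunctions (c 0).eval Y)).card) *
                (4 * (cl (subfunctions (c 1).eval Y)).card) := by ring
          _ ≤ 16 ^ (c 0).leavesIn Y * 16 ^ (c 1).leavesIn Y := Nat.mul_le_mul ih0 ih1
          _ = 16 ^ ((c 0).leavesIn Y + (c 1).leavesIn Y) := (pow_add _ _ _).symm
      · -- only input 0 reads `Y`: a "path" gate
        have h1' : (c 1).leavesIn Y = 0 := by omega
        have hsub : subfunctions (node j 2 op c).eval Y ⊆ cl (subfunctions (c 0).eval Y) := by
          refine subfunctions_subset_cl fun ρ => ?_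
          obtain ⟨b, hb⟩ := subfunction_eq_const_of_leavesIn_eq_zero (c 1) h1' ρ
          refine ⟨fun t => op ![t, b], funext fun y => ?_⟩
          have hb' := congrFun hb y
          simp only [subfunction, Function.comp, eval_node] at hb' ⊢
          congr 1
          funext a
          fin_cases a
          · simp
          · simpa using hb'
        calc 4 * (cl (subfunctions (node j 2 op c).eval Y)).card
            ≤ 4 * (cl (cl (subfunctions (c 0).eval Y))).card :=
              Nat.mul_le_mul_left 4 (card_le_card (cl_mono hsub))
          _ ≤ 4 * (cl (subfunctions (c 0).eval Y)).card :=
              Nat.mul_le_mul_left 4 (card_le_card (cl_cl_subset _))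
          _ ≤ 16 ^ (c 0).leavesIn Y := ih 0 (hc 0) h0
          _ = 16 ^ ((c 0).leavesIn Y + (c 1).leavesIn Y) := by rw [h1', add_zero]
      · -- only input 1 reads `Y`
        have h0' : (c 0).leavesIn Y = 0 := by omega
        have hsub : subfunctions (node j 2 op c).eval Y ⊆ cl (subfunctions (c 1).eval Y) := by
          refine subfunctions_subset_cl fun ρ => ?_
          obtain ⟨b, hb⟩ := subfunction_eq_const_of_leavesIn_eq_zero (c 0) h0' ρ
          refine ⟨fun t => op ![b, t], funext fun y => ?_⟩
          have hb' := congrFun hb y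
          simp only [subfunction, Function.comp, eval_node] at hb' ⊢
          congr 1
          funext a
          fin_cases a
          · simpa using hb'
          · simp
        calc 4 * (cl (subfunctions (node j 2 op c).eval Y)).card
            ≤ 4 * (cl (cl (subfunctions (c 1).eval Y))).card :=
              Nat.mul_le_mul_left 4 (card_le_card (cl_mono hsub))
          _ ≤ 4 * (cl (subfunctions (c 1).eval Y)).card :=
              Nat.mul_le_mul_left 4 (card_le_card (cl_cl_subset _))
          _ ≤ 16 ^ (c 1).leavesIn Y := ih 1 (hc 1) h1
          _ = 16 ^ ((c 0).leavesIn Y + (c 1).leavesIn Y) := by rw [h0', zero_add]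
      · omega

/-- **`log₂ s_Y ≤ 4 l_Y`** for a tree of fan-in `≤ 2` reading `Y` (the printed
`lᵢ ≥ ¼ log sᵢ`). [cite: Jukna2012, proof of Thm. 6.16 (PDF pp. 188–189)] -/
theorem logb_numSubfunctions_le (Y : Finset (Fin n)) (T : FTree n) (hT : T.FanIn2)
    (hl : 1 ≤ T.leavesIn Y) :
    Real.logb 2 (numSubfunctions T.eval Y : ℝ) ≤ 4 * (T.leavesIn Y : ℝ) := by
  have hS : numSubfunctions T.eval Y ≤ 2 ^ (4 * T.leavesIn Y) := by
    calc numSubfunctions T.eval Y = (subfunctions T.eval Y).card := rfl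
      _ ≤ (cl (subfunctions T.eval Y)).card := card_le_card (subset_cl _)
      _ ≤ 4 * (cl (subfunctions T.eval Y)).card := Nat.le_mul_of_pos_left _ (by norm_num)
      _ ≤ 16 ^ T.leavesIn Y := four_mul_card_cl_le Y T hT hl
      _ = 2 ^ (4 * T.leavesIn Y) := by rw [pow_mul]; norm_num
  have h := logb_two_le_of_le_two_pow (numSubfunctions_pos _ Y) hS
  exact_mod_cast h

end Count

end FTree

/-! ### Every Boolean function has a `B₂`-formula (so `formulaSizeOver B2 f` is attained) -/

section DNF

variable {ι : Type*}

/-- A *clean formula*: a formula (`IsFormula`: every gate is read by at most one argument slot)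
whose output gate is read by no gate — the invariant under which `Circuit.binop` builds formulas
(`Circuit.isFormula_binop`). [cite: Vollmer1999, §1.2] -/
def Clean (C : Circuit ι) : Prop := C.IsFormula ∧ ∀ m, C.output = .inr m → C.refCount m = 0

/-- The input formula is clean. [folklore] -/
theorem clean_input (i : ι) : Clean (Circuit.input i) := Circuit.isFormula_input i

/-- The constant formula is clean (its only gate has no argument slots). [folklore] -/
theorem clean_const (b : Bool) : Clean (Circuit.const ι b) := by
  constructor
  · intro m
    simp [Circuit.refCount, Circuit.const]
  · intro m _
    simp [Circuit.refCount, Circuit.const]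

/-- The constant formula is over `B₂` (a gate of fan-in `0`). [folklore] -/
theorem isOver_const (b : Bool) : (Circuit.const ι b).IsOver B2 := by
  intro g hg
  simp only [Circuit.const, List.mem_singleton] at hg
  subst hg
  show (0 : ℕ) ≤ 2
  omega

/-- A binary gate on top of two clean formulas is a clean formula. [cite: Vollmer1999, §1.2] -/
theorem clean_binop (op : (Fin 2 → Bool) → Bool) {C₁ C₂ : Circuit ι} (h₁ : Clean C₁)
    (h₂ : Clean C₂) : Clean (Circuit.binop op C₁ C₂) :=
  Circuit.isFormula_binop op h₁.1 h₁.2 h₂.1 h₂.2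

/-- Binary gates are in `B₂`. [cite: Jukna2012, §1.2] -/
theorem binop_mem_B2 (op : (Fin 2 → Bool) → Bool) : (⟨2, op⟩ : GateFn) ∈ B2 :=
  show (2 : ℕ) ≤ 2 from le_rfl

/-- Disjunction of a list of formulas (`false` for the empty list). [folklore] -/
def disj : List (Circuit ι) → Circuit ι
  | [] => Circuit.const ι false
  | C :: l => Circuit.binop (fun v => v 0 || v 1) C (disj l)

/-- `disj l` computes the disjunction. [folklore] -/
theorem eval_disj (x : ι → Bool) :
    ∀ l : List (Circuit ι), (disj l).eval x = true ↔ ∃ C ∈ l, C.eval x = true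
  | [] => by simp [disj]
  | C :: l => by
    rw [disj, Circuit.eval_binop]
    simp only [Matrix.cons_val_zero, Matrix.cons_val_one, Bool.or_eq_true, eval_disj x l,
      List.mem_cons, exists_eq_or_imp]

/-- `disj` of clean formulas is clean. [folklore] -/
theorem clean_disj : ∀ l : List (Circuit ι), (∀ C ∈ l, Clean C) → Clean (disj l)
  | [], _ => clean_const false
  | C :: l, h => clean_binop _ (h C (by simp)) (clean_disj l fun C' hC' => h C' (by simp [hC']))

/-- `disj` of `B₂`-formulas is over `B₂`. [folklore] -/
theorem isOver_disj : ∀ l : List (Circuit ι), (∀ C ∈ l, C.IsOver B2) → (disj l).IsOver B2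
  | [], _ => isOver_const false
  | C :: l, h => Circuit.isOver_binop (binop_mem_B2 _) (h C (by simp))
      (isOver_disj l fun C' hC' => h C' (by simp [hC']))

/-- Conjunction of a list of formulas (`true` for the empty list). [folklore] -/
def conj : List (Circuit ι) → Circuit ι
  | [] => Circuit.const ι true
  | C :: l => Circuit.binop (fun v => v 0 && v 1) C (conj l)

/-- `conj l` computes the conjunction. [folklore] -/
theorem eval_conj (x : ι → Bool) :
    ∀ l : List (Circuit ι), (conj l).eval x = true ↔ ∀ C ∈ l, C.eval x = true
  | [] => by simp [conj]
  | C :: l => by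
    rw [conj, Circuit.eval_binop]
    simp only [Matrix.cons_val_zero, Matrix.cons_val_one, Bool.and_eq_true, eval_conj x l,
      List.forall_mem_cons]

/-- `conj` of clean formulas is clean. [folklore] -/
theorem clean_conj : ∀ l : List (Circuit ι), (∀ C ∈ l, Clean C) → Clean (conj l)
  | [], _ => clean_const true
  | C :: l, h => clean_binop _ (h C (by simp)) (clean_conj l fun C' hC' => h C' (by simp [hC']))

/-- `conj` of `B₂`-formulas is over `B₂`. [folklore] -/
theorem isOver_conj : ∀ l : List (Circuit ι), (∀ C ∈ l, C.IsOver B2) → (conj l).IsOver B2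
  | [], _ => isOver_const true
  | C :: l, h => Circuit.isOver_binop (binop_mem_B2 _) (h C (by simp))
      (isOver_conj l fun C' hC' => h C' (by simp [hC']))

/-- The literal `xᵢ = bᵢ` as a one-gate formula. [folklore] -/
def lit (x : ι → Bool) (i : ι) : Circuit ι :=
  Circuit.binop (fun v => v 0 == x i) (Circuit.input i) (Circuit.input i)

/-- `lit x i` tests `yᵢ = xᵢ`. [folklore] -/
theorem eval_lit (x y : ι → Bool) (i : ι) : (lit x i).eval y = true ↔ y i = x i := by
  rw [lit, Circuit.eval_binop]
  simp

/-- `lit x i` is clean. [folklore] -/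
theorem clean_lit (x : ι → Bool) (i : ι) : Clean (lit x i) :=
  clean_binop _ (clean_input i) (clean_input i)

/-- `lit x i` is over `B₂`. [folklore] -/
theorem isOver_lit (x : ι → Bool) (i : ι) : (lit x i).IsOver B2 :=
  Circuit.isOver_binop (binop_mem_B2 _) (Circuit.isOver_input _ _) (Circuit.isOver_input _ _)

/-- The minterm of `x`. [folklore] -/
def minterm (x : Fin n → Bool) : Circuit (Fin n) := conj ((List.finRange n).map (lit x))

/-- The minterm of `x` accepts exactly `x`. [cite: Jukna2012, §1.1] -/
theorem eval_minterm (x y : Fin n → Bool) : (minterm x).eval y = true ↔ y = x := by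
  rw [minterm, eval_conj]
  simp only [List.forall_mem_map, List.mem_finRange, true_implies, eval_lit]
  exact funext_iff.symm

/-- The canonical DNF of `f` as a `B₂`-formula. [folklore] -/
def dnf (f : (Fin n → Bool) → Bool) : Circuit (Fin n) :=
  disj ((univ.filter fun x => f x = true).toList.map minterm)

/-- The canonical DNF of `f` computes `f`. [cite: Jukna2012, §1.1] -/
theorem computes_dnf (f : (Fin n → Bool) → Bool) : (dnf f).Computes f := by
  intro y
  rw [Bool.eq_iff_iff, dnf, eval_disj]
  constructor
  · rintro ⟨C, hC, hCy⟩
    rw [List.mem_map] at hC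
    obtain ⟨x, hx, rfl⟩ := hC
    rw [Finset.mem_toList, mem_filter] at hx
    rw [eval_minterm] at hCy
    rw [hCy]
    exact hx.2
  · intro hy
    refine ⟨minterm y, List.mem_map.2 ⟨y, ?_, rfl⟩, (eval_minterm y y).2 rfl⟩
    rw [Finset.mem_toList, mem_filter]
    exact ⟨mem_univ _, hy⟩

/-- The canonical DNF is a (clean) formula. [folklore] -/
theorem clean_dnf (f : (Fin n → Bool) → Bool) : Clean (dnf f) :=
  clean_disj _ fun C hC => by
    obtain ⟨x, -, rfl⟩ := List.mem_map.1 hC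
    exact clean_conj _ fun C' hC' => by
      obtain ⟨i, -, rfl⟩ := List.mem_map.1 hC'
      exact clean_lit x i

/-- The canonical DNF is over `B₂`. [folklore] -/
theorem isOver_dnf (f : (Fin n → Bool) → Bool) : (dnf f).IsOver B2 :=
  isOver_disj _ fun C hC => by
    obtain ⟨x, -, rfl⟩ := List.mem_map.1 hC
    exact isOver_conj _ fun C' hC' => by
      obtain ⟨i, -, rfl⟩ := List.mem_map.1 hC'
      exact isOver_lit x i

/-- **Every Boolean function has a formula over `B₂`** (its canonical DNF), so that
`formulaSizeOver B2 f` is an attained minimum. [cite: Jukna2012, §1.1] -/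
theorem exists_formula (f : (Fin n → Bool) → Bool) :
    ∃ C : Circuit (Fin n), C.IsOver B2 ∧ C.IsFormula ∧ C.Computes f :=
  ⟨dnf f, isOver_dnf f, (clean_dnf f).1, computes_dnf f⟩

end DNF

/-! ### Assembly -/

/-- **Nechiporuk's bound for one formula**: a `B₂`-formula with `s` gates computing `f`
gives `Σ_Y log₂ s_Y(f) ≤ 4 (s + 1)` for disjoint blocks each containing an essential variable.
[cite: Jukna2012, Thm. 6.16 (PDF pp. 188–189)] -/
theorem nechiporukSum_le_of_formula (C : Circuit (Fin n)) (hB : C.IsOver B2) (hF : C.IsFormula)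
    {f : (Fin n → Bool) → Bool} (hf : C.Computes f) (𝒴 : Finset (Finset (Fin n)))
    (hdisj : (𝒴 : Set (Finset (Fin n))).PairwiseDisjoint id)
    (hdep : ∀ Y ∈ 𝒴, ∃ i ∈ Y, IsEssentialVar f i) :
    nechiporukSum f 𝒴 ≤ 4 * ((C.size : ℝ) + 1) := by
  obtain ⟨T, hT2, hTg, hTe⟩ : ∃ T : FTree n, T.FanIn2 ∧ T.gcount ≤ C.size ∧
      ∀ x, T.eval x = C.eval x :=
    ⟨FTree.treeOf C, FTree.fanIn2_treeOf C hB, FTree.gcount_treeOf_le C hF, FTree.eval_treeOf C⟩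
  have hfT : T.eval = f := funext fun x => (hTe x).trans (hf x)
  subst hfT
  rw [nechiporukSum_def]
  calc ∑ Y ∈ 𝒴, Real.logb 2 (numSubfunctions T.eval Y : ℝ)
      ≤ ∑ Y ∈ 𝒴, (4 * (T.leavesIn Y : ℝ)) := sum_le_sum fun Y hY => by
        obtain ⟨i, hi, hess⟩ := hdep Y hY
        exact FTree.logb_numSubfunctions_le Y T hT2 (FTree.leavesIn_pos_of_isEssentialVar T hi hess)
    _ = 4 * ((∑ Y ∈ 𝒴, T.leavesIn Y : ℕ) : ℝ) := by rw [Nat.cast_sum, mul_sum]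
    _ ≤ 4 * (T.leaves : ℝ) := by gcongr; exact_mod_cast FTree.sum_leavesIn_le 𝒴 hdisj T
    _ ≤ 4 * ((T.gcount : ℝ) + 1) := by gcongr; exact_mod_cast FTree.leaves_le_gcount_succ T hT2
    _ ≤ 4 * ((C.size : ℝ) + 1) := by
        gcongr 4 * (?_ + 1)
        exact_mod_cast hTg

end Literature.Barriers.PneNP.Nechiporuk

namespace Literature.Barriers.PneNP

open Literature.Computability.Complexity Literature.Barriers.PneNP.Nechiporuk

/-- **Discharge of `Nechiporuk1966` (Jukna Thm. 6.16; Nechiporuk 1966).** For pairwise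
disjoint blocks each containing an essential variable of `f`,
`¼ Σ_Y log₂ s_Y(f) ≤ formulaSizeOver B2 f + 1`. [cite: Jukna2012, Thm. 6.16 (PDF pp. 188–189)] -/
theorem Nechiporuk1966_holds : Nechiporuk1966 := by
  intro n f 𝒴 hdisj hdep
  have hne : {s | ∃ C : Circuit (Fin n), C.IsOver B2 ∧ C.IsFormula ∧ C.Computes f ∧
      C.size = s}.Nonempty := by
    obtain ⟨C, hB, hF, hf⟩ := exists_formula f
    exact ⟨C.size, C, hB, hF, hf, rfl⟩
  obtain ⟨C, hB, hF, hf, hsize⟩ := Nat.sInf_mem hne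
  have hfs : formulaSizeOver B2 f = C.size := hsize.symm
  rw [hfs]
  have h := nechiporukSum_le_of_formula C hB hF hf 𝒴 hdisj hdep
  linarith

end Literature.Barriers.PneNP

end
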